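/-
Copyright (c) 2026 the pub-hodgecm-mathlib formalisation cell (harness21).  Prover seat hodgecm-mathlib-A-p12 (g21), 2026-09-01.  Road «S3-tree», brick T3′ «depth-zero κ-transfer»,
assembly row (P-1) (holder F0P3b-p01 (g12)), LAST MILE «ROW-0 PER LITERAL», FILE B: the Cayley literal `t′` of a congruent element near `1` and `n₀(t) = #Fix(t′)`.
-/
import Literature.NumberTheory.Rogawski1990.DepthZeroKappaTransferTypeOneUnitRow        -- ★ p846155 (F0P3b-p01 (g11)): binders, transports, `isRegularElt_of_eigenframe`, …
import Literature.NumberTheory.Automorphic.ResiduallyTrivialFixedCosetCountCayley      -- ★ p846223 (this seat): ROW-0 = `#Fix(Y)` at the CM place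
import Literature.NumberTheory.Automorphic.SplitTorusCayleyShiftValued                 -- ★ FILE A (this seat): shift-by-one orders, unitary eigenframe, `Valued` package
import Literature.NumberTheory.Automorphic.WhittakerCoeffLocalDatum                    -- ★ `isUniformizingElement_of_valued_eq`
import HarnessLib

/-!
# The depth-zero κ-transfer, type (1): the Cayley literal of a congruent element near `1`, and `n₀(t) = #Fix(t′)`
# (Kottwitz 1986 §3; Rogawski 1990 §4.9)

Topic `NumberTheory/Rogawski1990`; namespace `Literature.NumberTheory.Rogawski1990`.  THEOREMS ONLY (no definition, no instance, no notation, no named fact,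
no `sorry`); kernel lane `--supports stmt-HodgeConjecture-24833`.  Cell `pub/hodgecm-mathlib` (D-0151); road «S3-tree», brick T3′ «DEPTH-ZERO κ-TRANSFER»
(DESIGN v2), assembly row (P-1) `depthZeroKappaTransfer_hyperspecial_typeOne` (holder F0P3b-p01 (g12)), LAST MILE of its census row (i) «ROW-0 PER LITERAL»,
FILE B of three (★ FILE A `SplitTorusCayleyShiftValued` generic algebra; FILE C `DepthZeroKappaTransferTypeOneRowZero` the two heads).

THE MATHEMATICS (Kottwitz's level shift, [Rogawski1990, §4.9 p. 54]).  `t ∈ G′_v = U(H′)(L⁺_v)` is congruent (`ψ g = Tl g Tl⁻¹`) to `P₁·diag(x₁,x₂,x₃)·P₁⁻¹` for a frame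
`P₁` with diagonal `Φ₃`-Gram matrix (Flicker's `h`, `D_π h`: ★ `gram_flickerFrame(_pi)`), norm-one `x_i ≡ 1 (mod 𝔪_w)` at distances `q_w^{−P}, q_w^{−Q₁}, q_w^{−Q₂}`.  With a
`σ_w`-fixed uniformiser `ϖ` (★ `localConjDatum_adicCompletion`) put `Z_i = ϖ⁻¹(x_i−1)(x_i+1)⁻¹` (skew) and `Y_i = (1+Z_i)(1−Z_i)⁻¹` (norm one, `|Y_i − Y_j| = |x_i − x_j|∕|ϖ|`,
★ CAYLEY ∕ ★ FILE A).  The CAYLEY LITERAL `t′ := ψ⁻¹(P₁·diag(Y)·P₁⁻¹) ∈ G′_v` (★ FILE A `exists_mem_unitaryGroupOfForm_coe_eq_conj_diagonal`) shares the eigenframe `Q = Tl⁻¹P₁`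
with `t`; in that frame `X = 1 + ϖ⁻¹(t_w − 1)`, `Y_w`, `Y_w⁻¹` generate one order (★ `span_pow_one_add_eq`, ★ CAYLEY §1–§2, bridge ★ `conj_diagonal_mem_adjoin_of_mem_span_pow`), so
★ ROW-0 = `#Fix(Y)` (p846223) gives `n₀(t) = #Fix_{t′}(G′_v ⧸ K_v) = #{q ∈ U(σ_w,Φ₃)(L_w) ⧸ unitaryInt : (ψ t′)_w • q = q}` (★ `natCard_fixedCosets_eq`, ★
`natCard_fixedBy_cmLocalIntegralLevel_eq_of_congr`).

* §1 (the CM frame, any norm-one `Y`): `conj_eq_of_congr`, `mul_frame_eq_of_congr_conj_diagonal` (the explicit eigenframe `Q = Tl⁻¹ P₁`), `antidiagOne_map_algebraMap_localRing`,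
  **`exists_congr_conj_diagonal_of_gram`** (some `t′ ∈ G′_v` has `ψ t′ = P₁·diag(Y)·P₁⁻¹` and eigenframe `Q`).
* §2 **`exists_cayley_literal_of_congr_conj_diagonal`** — THE CORE: the Cayley literal `t′`, its norm-one eigenvalues, their SHIFTED distances `P − 1, Q₁ − 1, Q₂ − 1`,
  the finiteness of its fixed cosets in the one-place model, and `n₀(t) = #{q : (ψ t′)_w • q = q}`.

HONEST LABEL: HC_CM is proved only modulo the 2 remaining named inputs (hLiu418 24832, h413 24833) until rung 0 closes; this file is count-neutral.

## References
* [Rogawski1990] J. D. Rogawski, *Automorphic Representations of Unitary Groups in Three Variables* (1990), §4.9 p. 54, Prop. 4.9.1 (b) p. 55, §14.2 p. 233.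
* [Kottwitz1986] R. E. Kottwitz, *Base change for unit elements of Hecke algebras*, Compositio Math. 60 (1986), §3 (the level recursion of the fixed-vertex counts).
* [Flicker1998UnitaryFL] Y. Z. Flicker, *Elementary proof of the fundamental lemma for a unitary group*, Canad. J. Math. 50 (1998), §1 p. 76, §2 Prop. 3 p. 78.
* [PlatonovRapinchuk1994] V. Platonov, A. Rapinchuk, *Algebraic Groups and Number Theory* (1994), §2.3.
-/

set_option autoImplicit false

noncomputable section

open MeasureTheory Measure Set Function NumberField IsDedekindDomain Matrix Polynomial
open Literature.NumberTheory.Automorphic Literature.NumberTheory.Automorphic.UnitaryGroup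
open Literature.NumberTheory.Automorphic.IntegralReduction Literature.NumberTheory.GaloisRepresentations
open Literature.NumberTheory.Automorphic.HermitianLattice (unitaryInt LocalConjDatum)
open scoped Matrix MatrixGroups ValuativeRel

namespace Literature.NumberTheory.Rogawski1990

/-! ## §1 The CM frame: congruent elements with a prescribed conjugate-diagonal literal -/

section Frame

variable (L : Type) [Field L] [NumberField L] [IsCMField L] (H' : Matrix (Fin 3) (Fin 3) L)
  {v : HeightOneSpectrum (𝓞 ↥(maximalRealSubfield L))}

/-- `t = Tl⁻¹ · (ψ t) · Tl` on matrices, for a congruence `ψ g = Tl g Tl⁻¹`. [cite: Rogawski1990, §14.2 p. 233] -/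
theorem conj_eq_of_congr (Tl : GL (Fin 3) (LocalRing L v))
    (ψ : ↥(UnitaryGroup.«local» L (IsCMField.complexConj L) 3 H' v) ≃ₜ*
        ↥(UnitaryGroup.«local» L (IsCMField.complexConj L) 3 (Matrix.of fun i j : Fin 3 => if i.val + j.val + 1 = 3 then (1 : L) else 0) v))
    (hψ : ∀ g, (ψ g).val = Tl * g.val * Tl⁻¹) (t : (cmDatum L 3 H').Local v) :
    (t.val.val : Matrix (Fin 3) (Fin 3) (LocalRing L v)) = Tl⁻¹.val * (ψ t).val.val * Tl.val := by
  rw [hψ t, Units.val_mul, Units.val_mul, ← Matrix.mul_assoc, ← Matrix.mul_assoc, ← Units.val_mul, inv_mul_cancel, Units.val_one, Matrix.one_mul,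
    Matrix.mul_assoc, ← Units.val_mul, inv_mul_cancel, Units.val_one, Matrix.mul_one]

/-- **THE EXPLICIT EIGENFRAME**: if `ψ t = P₁·diag(x)·P₁⁻¹` then `t · Q = Q · diag(x)` for `Q = Tl⁻¹ P₁`. [cite: Flicker1998UnitaryFL, §2 Prop. 3 p. 78] -/
theorem mul_frame_eq_of_congr_conj_diagonal (Tl : GL (Fin 3) (LocalRing L v))
    (ψ : ↥(UnitaryGroup.«local» L (IsCMField.complexConj L) 3 H' v) ≃ₜ*
        ↥(UnitaryGroup.«local» L (IsCMField.complexConj L) 3 (Matrix.of fun i j : Fin 3 => if i.val + j.val + 1 = 3 then (1 : L) else 0) v))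
    (hψ : ∀ g, (ψ g).val = Tl * g.val * Tl⁻¹) (t : (cmDatum L 3 H').Local v) (P₁ : GL (Fin 3) (LocalRing L v)) {x : Fin 3 → LocalRing L v}
    (hlit : (ψ t).val.val = P₁.val * diagonal x * (P₁⁻¹).val) :
    (t.val.val : Matrix (Fin 3) (Fin 3) (LocalRing L v)) * (Tl⁻¹ * P₁).val = (Tl⁻¹ * P₁).val * diagonal x := by
  rw [conj_eq_of_congr L H' Tl ψ hψ t, Units.val_mul, hlit, Matrix.mul_assoc, Matrix.mul_assoc, Matrix.mul_assoc, ← Matrix.mul_assoc Tl.val, ← Units.val_mul,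
    mul_inv_cancel, Units.val_one, Matrix.one_mul, ← Units.val_mul P₁⁻¹, inv_mul_cancel, Units.val_one, Matrix.mul_one, ← Matrix.mul_assoc]

omit [IsCMField L] in
/-- `Φ₃ ⊗ 1 = Φ₃` over `E_v`: the antidiagonal form mapped to `LocalRing L v` is the antidiagonal form there. [cite: Rogawski1990, §14.2 p. 233] -/
theorem antidiagOne_map_algebraMap_localRing :
    (Matrix.of fun i j : Fin 3 => if i.val + j.val + 1 = 3 then (1 : L) else 0).map (algebraMap L (LocalRing L v)) =
      Matrix.of fun i j : Fin 3 => if i.val + j.val + 1 = 3 then (1 : LocalRing L v) else 0 := by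
  ext i j
  simp only [Matrix.map_apply, Matrix.of_apply]
  split_ifs <;> simp

/-- **A CONGRUENT ELEMENT WITH PRESCRIBED UNITARY EIGENFRAME**: for a frame `P₁ ∈ GL₃(E_v)` whose Gram matrix for `Φ₃` is diagonal and norm-one `Y_i ∈ E_v`, there is
`t′ ∈ G′_v` with `ψ t′ = P₁·diag(Y)·P₁⁻¹` (★ FILE A `exists_mem_unitaryGroupOfForm_coe_eq_conj_diagonal` puts `P₁·diag(Y)·P₁⁻¹` in `U(Φ₃)(L⁺_v)`; pull back by `ψ⁻¹`) and
eigenframe `t′ · Q = Q · diag(Y)`, `Q = Tl⁻¹ P₁`. [cite: Flicker1998UnitaryFL, §2 Prop. 3 p. 78] [cite: PlatonovRapinchuk1994, §2.3] -/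
theorem exists_congr_conj_diagonal_of_gram (Tl : GL (Fin 3) (LocalRing L v))
    (ψ : ↥(UnitaryGroup.«local» L (IsCMField.complexConj L) 3 H' v) ≃ₜ*
        ↥(UnitaryGroup.«local» L (IsCMField.complexConj L) 3 (Matrix.of fun i j : Fin 3 => if i.val + j.val + 1 = 3 then (1 : L) else 0) v))
    (hψ : ∀ g, (ψ g).val = Tl * g.val * Tl⁻¹) (P₁ : GL (Fin 3) (LocalRing L v)) {d : Fin 3 → LocalRing L v}
    (hG : ((P₁.val : Matrix (Fin 3) (Fin 3) (LocalRing L v)).map (conjLocal L (IsCMField.complexConj L) v))ᵀ *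
        (Matrix.of fun i j : Fin 3 => if i.val + j.val + 1 = 3 then (1 : LocalRing L v) else 0) * P₁.val = diagonal d)
    {Y : Fin 3 → LocalRing L v} (hY : ∀ i, conjLocal L (IsCMField.complexConj L) v (Y i) * Y i = 1) :
    ∃ t' : (cmDatum L 3 H').Local v, (ψ t').val.val = P₁.val * diagonal Y * (P₁⁻¹).val ∧
      (t'.val.val : Matrix (Fin 3) (Fin 3) (LocalRing L v)) * (Tl⁻¹ * P₁).val = (Tl⁻¹ * P₁).val * diagonal Y := by
  obtain ⟨g, hg, hgval⟩ := exists_mem_unitaryGroupOfForm_coe_eq_conj_diagonal (conjLocal L (IsCMField.complexConj L) v)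
    (Matrix.of fun i j : Fin 3 => if i.val + j.val + 1 = 3 then (1 : LocalRing L v) else 0) P₁ hG hY
  have hg' : g ∈ UnitaryGroup.«local» L (IsCMField.complexConj L) 3 (Matrix.of fun i j : Fin 3 => if i.val + j.val + 1 = 3 then (1 : L) else 0) v := by
    rw [local_eq_unitaryGroupOfForm_map, antidiagOne_map_algebraMap_localRing]
    exact hg
  refine ⟨ψ.symm ⟨g, hg'⟩, ?_, ?_⟩
  · rw [ContinuousMulEquiv.apply_symm_apply]
    exact hgval
  · have h := mul_frame_eq_of_congr_conj_diagonal L H' Tl ψ hψ (ψ.symm ⟨g, hg'⟩) P₁ (x := Y) (by rw [ContinuousMulEquiv.apply_symm_apply]; exact hgval)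
    exact h

end Frame

/-! ## §2 The core: the Cayley literal of a congruent element near `1` and `n₀(t) = #Fix(t′)` -/

section Core

variable (L : Type) [Field L] [NumberField L] [IsCMField L] (H' : Matrix (Fin 3) (Fin 3) L)
  {v : HeightOneSpectrum (𝓞 ↥(maximalRealSubfield L))}

set_option synthInstance.maxHeartbeats 200000 in  -- the coset actions `U_w ↷ U_w ⧸ unitaryInt`, `G′_v ↷ G′_v ⧸ K_v` (as in ★ `FixedCosetsTransport`)
set_option maxHeartbeats 800000 in  -- one long assembly proof over the heavy one-place carriers
open scoped Classical in
/-- **THE CAYLEY LITERAL (core of ROW 0)**: for `t ∈ G′_v` congruent to `P₁·diag(x₁,x₂,x₃)·P₁⁻¹` (`P₁` a frame with diagonal `Φ₃`-Gram matrix; `x_i` norm one, pairwise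
distinct, `≡ 1 (mod 𝔪_w)`, at distances `P, Q₁, Q₂`) at an unramified `v ∤ 2`, there are norm-one `Y₁, Y₂, Y₃ ∈ E_v` and `t′ ∈ G′_v` congruent to `P₁·diag(Y)·P₁⁻¹` with
distances `P − 1, Q₁ − 1, Q₂ − 1` at `w`, finitely many `t′`-fixed cosets in the one-place model, and
`n₀(t) = #{q ∈ U(σ_w, Φ₃)(L_w) ⧸ unitaryInt : (ψ t′)_w • q = q}` — the Cayley shift read through ★ ROW-0 = `#Fix(Y)`, ★ `natCard_fixedCosets_eq` and ★
`natCard_fixedBy_cmLocalIntegralLevel_eq_of_congr`. [cite: Kottwitz1986, §3] [cite: Rogawski1990, §4.9 p. 54, Prop. 4.9.1 (b) p. 55] -/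
theorem exists_cayley_literal_of_congr_conj_diagonal
    (hH' : (H'.map (IsCMField.complexConj L))ᵀ = H') (hH'u : IsUnit H') (w : PlacesOver L v)
    (hw : IsCMField.complexConj L • w.1 = w.1) (hv : Algebra.IsUnramifiedIn (𝓞 L) v.asIdeal)
    (h2 : IsUnit (2 : 𝒪[w.1.adicCompletion L]))
    {x₁ x₂ x₃ : LocalRing L v}
    (hx₁ : conjLocal L (IsCMField.complexConj L) v x₁ * x₁ = 1) (hx₂ : conjLocal L (IsCMField.complexConj L) v x₂ * x₂ = 1)
    (hx₃ : conjLocal L (IsCMField.complexConj L) v x₃ * x₃ = 1)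
    (Tl : GL (Fin 3) (LocalRing L v))
    (ψ : ↥(UnitaryGroup.«local» L (IsCMField.complexConj L) 3 H' v) ≃ₜ*
        ↥(UnitaryGroup.«local» L (IsCMField.complexConj L) 3 (Matrix.of fun i j : Fin 3 => if i.val + j.val + 1 = 3 then (1 : L) else 0) v))
    (t : (cmDatum L 3 H').Local v)
    (hψ : ∀ g, (ψ g).val = Tl * g.val * Tl⁻¹)
    (hlev : ∀ g, g ∈ cmLocalIntegralLevel L 3 H' v ↔
        ψ g ∈ cmLocalIntegralLevel L 3 (Matrix.of fun i j : Fin 3 => if i.val + j.val + 1 = 3 then (1 : L) else 0) v)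
    (P₁ : GL (Fin 3) (LocalRing L v)) {d : Fin 3 → LocalRing L v}
    (hG : ((P₁.val : Matrix (Fin 3) (Fin 3) (LocalRing L v)).map (conjLocal L (IsCMField.complexConj L) v))ᵀ *
        (Matrix.of fun i j : Fin 3 => if i.val + j.val + 1 = 3 then (1 : LocalRing L v) else 0) * P₁.val = diagonal d)
    (hlit : (ψ t).val.val = P₁.val * diagonal ![x₁, x₂, x₃] * (P₁⁻¹).val)
    {P Q₁ Q₂ : ℕ} (hP : Valued.v (x₁ w - x₃ w) = WithZero.exp (-(P : ℤ))) (hQ₁ : Valued.v (x₁ w - x₂ w) = WithZero.exp (-(Q₁ : ℤ)))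
    (hQ₂ : Valued.v (x₃ w - x₂ w) = WithZero.exp (-(Q₂ : ℤ)))
    (hd₁ : Valued.v (x₁ w - 1) < 1) (hd₂ : Valued.v (x₂ w - 1) < 1) (hd₃ : Valued.v (x₃ w - 1) < 1) :
    ∃ (Y₁ Y₂ Y₃ : LocalRing L v) (t' : (cmDatum L 3 H').Local v),
      (ψ t').val.val = P₁.val * diagonal ![Y₁, Y₂, Y₃] * (P₁⁻¹).val ∧
      galAdicCompletionMap (L := L) (IsCMField.complexConj L) hw (Y₁ w) * Y₁ w = 1 ∧
      galAdicCompletionMap (L := L) (IsCMField.complexConj L) hw (Y₂ w) * Y₂ w = 1 ∧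
      galAdicCompletionMap (L := L) (IsCMField.complexConj L) hw (Y₃ w) * Y₃ w = 1 ∧
      Valued.v (Y₁ w - Y₃ w) = WithZero.exp (-((P - 1 : ℕ) : ℤ)) ∧ Valued.v (Y₁ w - Y₂ w) = WithZero.exp (-((Q₁ - 1 : ℕ) : ℤ)) ∧
      Valued.v (Y₃ w - Y₂ w) = WithZero.exp (-((Q₂ - 1 : ℕ) : ℤ)) ∧
      {q : ↥(unitaryGroupOfForm (galAdicCompletionMap (L := L) (IsCMField.complexConj L) hw)
          (placeForm (Matrix.of fun i j : Fin 3 => if i.val + j.val + 1 = 3 then (1 : L) else 0) w.1)) ⧸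
        unitaryInt (galAdicCompletionMap (L := L) (IsCMField.complexConj L) hw)
          (placeForm (Matrix.of fun i j : Fin 3 => if i.val + j.val + 1 = 3 then (1 : L) else 0) w.1) |
        localNonsplitEquiv (IsCMField.complexConj L) (Matrix.of fun i j : Fin 3 => if i.val + j.val + 1 = 3 then (1 : L) else 0)
          (IsCMField.complexConj_ne_one L) w hw (ψ t') • q = q}.Finite ∧
      {q : (cmDatum L 3 H').Local v ⧸ cmLocalIntegralLevel L 3 H' v |
        q ∈ MulAction.fixedBy ((cmDatum L 3 H').Local v ⧸ cmLocalIntegralLevel L 3 H' v) t ∧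
          (redMat ((((q.out⁻¹ * t * q.out : (cmDatum L 3 H').Local v)).val : GL (Fin 3) (LocalRing L v)).val.map
            (Pi.evalRingHom (fun w' : PlacesOver L v => w'.1.adicCompletion L) w)) - 1).rank = 0}.ncard =
      Nat.card {q : ↥(unitaryGroupOfForm (galAdicCompletionMap (L := L) (IsCMField.complexConj L) hw)
          (placeForm (Matrix.of fun i j : Fin 3 => if i.val + j.val + 1 = 3 then (1 : L) else 0) w.1)) ⧸
        unitaryInt (galAdicCompletionMap (L := L) (IsCMField.complexConj L) hw)
          (placeForm (Matrix.of fun i j : Fin 3 => if i.val + j.val + 1 = 3 then (1 : L) else 0) w.1) |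
        localNonsplitEquiv (IsCMField.complexConj L) (Matrix.of fun i j : Fin 3 => if i.val + j.val + 1 = 3 then (1 : L) else 0)
          (IsCMField.complexConj_ne_one L) w hw (ψ t') • q = q} := by
  have hc1 : IsCMField.complexConj L ≠ 1 := IsCMField.complexConj_ne_one L
  haveI : Algebra.IsQuadraticExtension ↥(maximalRealSubfield L) L := IsCMField.isQuadraticExtension L
  haveI : Subsingleton (PlacesOver L v) := PlacesOver.subsingleton_of_smul_eq (IsCMField.complexConj L) hc1 w hw
  letI : Unique (PlacesOver L v) := uniqueOfSubsingleton w
  let πe : LocalRing L v ≃+* w.1.adicCompletion L := RingEquiv.piUnique fun w' : PlacesOver L v => w'.1.adicCompletion L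
  have hπe : ∀ z : w.1.adicCompletion L, πe.symm z w = z := fun z => πe.apply_symm_apply z
  have hπe' : ∀ z : LocalRing L v, πe z = z w := fun z => rfl
  -- (0) `H′` hermitian invertible; `σ` at `w`; `2 ∉ v`
  have hH'c : (H'.map (cmConjRingHom L))ᵀ = H' := by
    have e1 : H'.map (cmConjRingHom L) = H'.map (IsCMField.complexConj L) := by
      ext i j; simp [Matrix.map_apply, cmConjRingHom_apply]
    rw [e1]; exact hH'
  have hdet : H'.det ≠ 0 := (Matrix.isUnit_iff_isUnit_det _ |>.1 hH'u).ne_zero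
  have hσw : ∀ z : LocalRing L v, conjLocal L (IsCMField.complexConj L) v z w = galAdicCompletionMap (L := L) (IsCMField.complexConj L) hw (z w) :=
    fun z => conjLocal_apply_eq_of_smul_eq (IsCMField.complexConj L) hc1 v w hw z
  have h2L : (2 : 𝓞 L) ∉ w.1.asIdeal := by
    have h2w : Valued.v (2 : w.1.adicCompletion L) = 1 := (isUnit_two_integer_iff_valued_eq_one L w.1).1 h2
    have e1 : (algebraMap L (w.1.adicCompletion L)) (algebraMap (𝓞 L) L 2) = 2 := by rw [map_ofNat, map_ofNat]
    rw [← e1] at h2w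
    change Valued.v ((algebraMap (𝓞 L) L 2 : L) : w.1.adicCompletion L) = 1 at h2w
    rw [HeightOneSpectrum.valuedAdicCompletion_eq_valuation', HeightOneSpectrum.valuation_of_algebraMap] at h2w
    exact HeightOneSpectrum.intValuation_eq_one_iff.1 h2w
  have h2F : (2 : 𝓞 ↥(maximalRealSubfield L)) ∉ v.asIdeal := by
    intro hmem
    apply h2L
    have h := congrArg HeightOneSpectrum.asIdeal w.2
    rw [← h] at hmem
    simp only [HeightOneSpectrum.under_asIdeal, Ideal.under_def, Ideal.mem_comap, map_ofNat] at hmem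
    exact hmem
  have hx₁w : galAdicCompletionMap (L := L) (IsCMField.complexConj L) hw (x₁ w) * x₁ w = 1 := by rw [← hσw]; exact (congrFun hx₁ w : _)
  have hx₂w : galAdicCompletionMap (L := L) (IsCMField.complexConj L) hw (x₂ w) * x₂ w = 1 := by rw [← hσw]; exact (congrFun hx₂ w : _)
  have hx₃w : galAdicCompletionMap (L := L) (IsCMField.complexConj L) hw (x₃ w) * x₃ w = 1 := by rw [← hσw]; exact (congrFun hx₃ w : _)
  -- (1) the `σ_w`-fixed uniformiser `ϖ` and the two valuation currencies
  obtain ⟨ϖ, hdϖ⟩ := localConjDatum_adicCompletion (IsCMField.complexConj L) hc1 v w hw hv h2F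
  have hϖU : IsUniformizingElement ϖ := isUniformizingElement_of_valued_eq L w.1 hdϖ.vϖ
  have hϖ0 : ϖ ≠ 0 := hϖU.ne_zero
  have hiso := ValuativeRel.isEquiv (ValuativeRel.valuation (w.1.adicCompletion L)) (Valued.v : Valuation (w.1.adicCompletion L) (WithZero (Multiplicative ℤ)))
  have hmemO : ∀ {z : w.1.adicCompletion L}, Valued.v z ≤ 1 → z ∈ 𝒪[w.1.adicCompletion L] :=
    fun hz => (Valuation.mem_integer_iff _ _).2 (hiso.le_one_iff_le_one.2 hz)
  have v2 : Valued.v (2 : w.1.adicCompletion L) = 1 := hdϖ.v2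
  have h20 : (2 : w.1.adicCompletion L) ≠ 0 := fun h0 => by rw [h0, map_zero] at v2; exact zero_ne_one v2
  have h2O : (2 : w.1.adicCompletion L)⁻¹ ∈ 𝒪[w.1.adicCompletion L] := hmemO (by rw [map_inv₀, v2, inv_one])
  -- (2) the scalar Cayley data at `w`
  have hxw : ∀ i, Valued.v ((![x₁ w, x₂ w, x₃ w] : Fin 3 → w.1.adicCompletion L) i - 1) < 1 := by
    intro i; fin_cases i
    · exact hd₁
    · exact hd₂
    · exact hd₃
  have hxn : ∀ i, galAdicCompletionMap (L := L) (IsCMField.complexConj L) hw ((![x₁ w, x₂ w, x₃ w] : Fin 3 → w.1.adicCompletion L) i) *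
      (![x₁ w, x₂ w, x₃ w] : Fin 3 → w.1.adicCompletion L) i = 1 := by
    intro i; fin_cases i
    · exact hx₁w
    · exact hx₂w
    · exact hx₃w
  have hx1 : ∀ i, Valued.v ((![x₁ w, x₂ w, x₃ w] : Fin 3 → w.1.adicCompletion L) i + 1) = 1 := fun i => valued_add_one_eq_one v2 (hxw i)
  have hx10 : ∀ i, (![x₁ w, x₂ w, x₃ w] : Fin 3 → w.1.adicCompletion L) i + 1 ≠ 0 := fun i h0 => by
    have := hx1 i; rw [h0, map_zero] at this; exact zero_ne_one this
  have hZle : ∀ i, Valued.v (ϖ⁻¹ * (((![x₁ w, x₂ w, x₃ w] : Fin 3 → w.1.adicCompletion L) i - 1) / ((![x₁ w, x₂ w, x₃ w] : Fin 3 → w.1.adicCompletion L) i + 1))) ≤ 1 :=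
    fun i => valued_shift_cayleyParam_le_one v2 hdϖ.vϖ (hxw i)
  have hσZ : ∀ i, galAdicCompletionMap (L := L) (IsCMField.complexConj L) hw
      (ϖ⁻¹ * (((![x₁ w, x₂ w, x₃ w] : Fin 3 → w.1.adicCompletion L) i - 1) / ((![x₁ w, x₂ w, x₃ w] : Fin 3 → w.1.adicCompletion L) i + 1))) =
      -(ϖ⁻¹ * (((![x₁ w, x₂ w, x₃ w] : Fin 3 → w.1.adicCompletion L) i - 1) / ((![x₁ w, x₂ w, x₃ w] : Fin 3 → w.1.adicCompletion L) i + 1))) :=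
    fun i => map_shift_cayleyParam_eq_neg _ hdϖ.σϖ (hxn i) (hx10 i)
  have h1Z : ∀ i, Valued.v (1 - ϖ⁻¹ * (((![x₁ w, x₂ w, x₃ w] : Fin 3 → w.1.adicCompletion L) i - 1) / ((![x₁ w, x₂ w, x₃ w] : Fin 3 → w.1.adicCompletion L) i + 1))) = 1 ∧
      Valued.v (1 + ϖ⁻¹ * (((![x₁ w, x₂ w, x₃ w] : Fin 3 → w.1.adicCompletion L) i - 1) / ((![x₁ w, x₂ w, x₃ w] : Fin 3 → w.1.adicCompletion L) i + 1))) = 1 :=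
    fun i => valued_one_sub_eq_one_and_of_map_eq_neg hdϖ.vσ v2 (hZle i) (hσZ i)
  have h1Zm0 : ∀ i, 1 - ϖ⁻¹ * (((![x₁ w, x₂ w, x₃ w] : Fin 3 → w.1.adicCompletion L) i - 1) / ((![x₁ w, x₂ w, x₃ w] : Fin 3 → w.1.adicCompletion L) i + 1)) ≠ 0 :=
    fun i h0 => by have := (h1Z i).1; rw [h0, map_zero] at this; exact zero_ne_one this
  have h1Zp0 : ∀ i, 1 + ϖ⁻¹ * (((![x₁ w, x₂ w, x₃ w] : Fin 3 → w.1.adicCompletion L) i - 1) / ((![x₁ w, x₂ w, x₃ w] : Fin 3 → w.1.adicCompletion L) i + 1)) ≠ 0 :=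
    fun i h0 => by have := (h1Z i).2; rw [h0, map_zero] at this; exact zero_ne_one this
  -- the Cayley shifts `Yf i = (1 + Z_i)/(1 − Z_i)` (field) and their lifts `Yv i` to `E_v`
  obtain ⟨Yf, hYf⟩ : ∃ Yf : Fin 3 → w.1.adicCompletion L, Yf = fun i =>
    (1 + ϖ⁻¹ * (((![x₁ w, x₂ w, x₃ w] : Fin 3 → w.1.adicCompletion L) i - 1) / ((![x₁ w, x₂ w, x₃ w] : Fin 3 → w.1.adicCompletion L) i + 1))) /
      (1 - ϖ⁻¹ * (((![x₁ w, x₂ w, x₃ w] : Fin 3 → w.1.adicCompletion L) i - 1) / ((![x₁ w, x₂ w, x₃ w] : Fin 3 → w.1.adicCompletion L) i + 1))) := ⟨_, rfl⟩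
  have hYfi : ∀ i, Yf i = (1 + ϖ⁻¹ * (((![x₁ w, x₂ w, x₃ w] : Fin 3 → w.1.adicCompletion L) i - 1) / ((![x₁ w, x₂ w, x₃ w] : Fin 3 → w.1.adicCompletion L) i + 1))) /
      (1 - ϖ⁻¹ * (((![x₁ w, x₂ w, x₃ w] : Fin 3 → w.1.adicCompletion L) i - 1) / ((![x₁ w, x₂ w, x₃ w] : Fin 3 → w.1.adicCompletion L) i + 1))) :=
    fun i => by rw [hYf]
  have hYn : ∀ i, galAdicCompletionMap (L := L) (IsCMField.complexConj L) hw (Yf i) * Yf i = 1 :=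
    fun i => by rw [hYfi]; exact map_cayley_mul_cayley _ (hσZ i) (h1Zm0 i) (h1Zp0 i)
  have hY0 : ∀ i, Yf i ≠ 0 := fun i h0 => by have := hYn i; rw [h0, mul_zero] at this; exact zero_ne_one this
  have hYsub : ∀ i j, Valued.v (Yf i - Yf j) = Valued.v ((![x₁ w, x₂ w, x₃ w] : Fin 3 → w.1.adicCompletion L) i - (![x₁ w, x₂ w, x₃ w] : Fin 3 → w.1.adicCompletion L) j) /
      Valued.v ϖ := fun i j => by rw [hYfi, hYfi]; exact valued_cayley_sub_cayley v2 (hx1 i) (hx1 j) (h1Z i).1 (h1Z j).1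
  obtain ⟨Yv, hYv⟩ : ∃ Yv : Fin 3 → LocalRing L v, Yv = fun i => πe.symm (Yf i) := ⟨_, rfl⟩
  have hYvw : ∀ i, Yv i w = Yf i := fun i => by rw [hYv]; exact hπe (Yf i)
  have hYvn : ∀ i, conjLocal L (IsCMField.complexConj L) v (Yv i) * Yv i = 1 := by
    intro i
    apply πe.injective
    rw [map_mul, map_one, hπe', hπe', hσw, hYvw]
    exact hYn i
  have hYvinj : Function.Injective ![Yv 0, Yv 1, Yv 2] := by
    have hne : ∀ i j, (![x₁ w, x₂ w, x₃ w] : Fin 3 → w.1.adicCompletion L) i ≠ (![x₁ w, x₂ w, x₃ w] : Fin 3 → w.1.adicCompletion L) j → Yv i ≠ Yv j := by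
      intro i j hij hY
      have hY' : Yf i = Yf j := by rw [← hYvw, ← hYvw, hY]
      have h := hYsub i j
      rw [hY', sub_self, map_zero, eq_comm, div_eq_zero_iff, map_eq_zero, map_eq_zero, sub_eq_zero] at h
      exact h.elim hij hϖ0
    have h12 : x₁ w ≠ x₂ w := fun h => by have := hQ₁; rw [h, sub_self, map_zero] at this; exact WithZero.exp_ne_zero this.symm
    have h13 : x₁ w ≠ x₃ w := fun h => by have := hP; rw [h, sub_self, map_zero] at this; exact WithZero.exp_ne_zero this.symm
    have h32 : x₃ w ≠ x₂ w := fun h => by have := hQ₂; rw [h, sub_self, map_zero] at this; exact WithZero.exp_ne_zero this.symm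
    intro i j hij
    fin_cases i <;> fin_cases j
    all_goals first | rfl | (exfalso; revert hij; simp only [imp_false, ← ne_eq])
    exacts [hne 0 1 h12, hne 0 2 h13, (hne 0 1 h12).symm, hne 1 2 h32.symm, (hne 0 2 h13).symm, (hne 1 2 h32.symm).symm]
  -- (3) the Cayley literal `t′` and the common eigenframe `Q = Tl⁻¹ P₁`
  have hYv3 : (![Yv 0, Yv 1, Yv 2] : Fin 3 → LocalRing L v) = Yv := by funext i; fin_cases i <;> rfl
  obtain ⟨t', hlit', hQ'⟩ := exists_congr_conj_diagonal_of_gram L H' Tl ψ hψ P₁ hG (Y := ![Yv 0, Yv 1, Yv 2]) (fun i => by rw [hYv3]; exact hYvn i)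
  have hQ := mul_frame_eq_of_congr_conj_diagonal L H' Tl ψ hψ t P₁ hlit
  -- (4) `t′` is regular elliptic: finitely many fixed cosets
  have hreg' : IsRegularElt (t'.val : GL (Fin 3) (LocalRing L v)) := isRegularElt_of_eigenframe L H' w hw t' hQ' hYvinj
  haveI : CompactSpace (Subgroup.centralizer ({t'} : Set ((cmDatum L 3 H').Local v))) :=
    compactSpace_centralizer_of_eigenframe_of_smul_eq L w hw H' hH'c hdet t' hQ' hYvinj (fun i => by rw [hYv3]; exact hYvn i)
  have hfinG : (MulAction.fixedBy ((cmDatum L 3 H').Local v ⧸ cmLocalIntegralLevel L 3 H' v) t').Finite :=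
    finite_fixedBy_quotient_of_isClosed t' (cmLocalIntegralLevel L 3 H' v) (isClosed_conjClass_local_of_isRegularElt L 3 H' v hH'c hdet t' hreg')
      (isCompact_isOpen_cmLocalIntegralLevel L 3 H' v).2 (isCompact_isOpen_cmLocalIntegralLevel L 3 H' v).1
  have hfin := (finite_fixedBy_cmLocalIntegralLevel_iff_of_congr L H' w hw ψ hlev t').1 hfinG
  -- (5) the frames read at `w`
  set f := Pi.evalRingHom (fun w' : PlacesOver L v => w'.1.adicCompletion L) w with hf
  set Qw : GL (Fin 3) (w.1.adicCompletion L) := Matrix.GeneralLinearGroup.map f (Tl⁻¹ * P₁) with hQw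
  have hQwval : (Qw : Matrix (Fin 3) (Fin 3) (w.1.adicCompletion L)) = ((Tl⁻¹ * P₁).val : Matrix (Fin 3) (Fin 3) (LocalRing L v)).map f := rfl
  have hQQ : (Qw : Matrix (Fin 3) (Fin 3) (w.1.adicCompletion L)) * ((Qw⁻¹ : GL (Fin 3) (w.1.adicCompletion L)) : Matrix (Fin 3) (Fin 3) (w.1.adicCompletion L)) = 1 := by
    rw [← Units.val_mul, mul_inv_cancel, Units.val_one]
  have hframe : ∀ (u : (cmDatum L 3 H').Local v) (z : Fin 3 → LocalRing L v),
      (u.val.val : Matrix (Fin 3) (Fin 3) (LocalRing L v)) * (Tl⁻¹ * P₁).val = (Tl⁻¹ * P₁).val * diagonal z →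
      (((localNonsplitEquiv (IsCMField.complexConj L) H' hc1 w hw u :
          unitaryGroupOfForm (galAdicCompletionMap (L := L) (IsCMField.complexConj L) hw) (placeForm H' w.1)) :
          GL (Fin 3) (w.1.adicCompletion L)) : Matrix (Fin 3) (Fin 3) (w.1.adicCompletion L)) =
        (Qw : Matrix (Fin 3) (Fin 3) (w.1.adicCompletion L)) * diagonal (fun i => z i w) * ((Qw⁻¹ : GL (Fin 3) (w.1.adicCompletion L)) : Matrix (Fin 3) (Fin 3) (w.1.adicCompletion L)) := by
    intro u z hu
    have h := congrArg (fun M : Matrix (Fin 3) (Fin 3) (LocalRing L v) => M.map f) hu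
    simp only [Matrix.map_mul, diagonal_map (map_zero f)] at h
    have e0 : (((localNonsplitEquiv (IsCMField.complexConj L) H' hc1 w hw u :
          unitaryGroupOfForm (galAdicCompletionMap (L := L) (IsCMField.complexConj L) hw) (placeForm H' w.1)) :
          GL (Fin 3) (w.1.adicCompletion L)) : Matrix (Fin 3) (Fin 3) (w.1.adicCompletion L)) = (u.val.val : Matrix (Fin 3) (Fin 3) (LocalRing L v)).map f :=
      coe_coe_localNonsplitEquiv_apply (c := IsCMField.complexConj L) (N := 3) (J := H') (hc := hc1) (w := w) (hw := hw) (g := u)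
    rw [e0]
    calc (u.val.val : Matrix (Fin 3) (Fin 3) (LocalRing L v)).map f
          = (u.val.val : Matrix (Fin 3) (Fin 3) (LocalRing L v)).map f *
              ((Qw : Matrix (Fin 3) (Fin 3) (w.1.adicCompletion L)) * ((Qw⁻¹ : GL (Fin 3) (w.1.adicCompletion L)) : Matrix (Fin 3) (Fin 3) (w.1.adicCompletion L))) := by
            rw [hQQ, Matrix.mul_one]
      _ = ((u.val.val : Matrix (Fin 3) (Fin 3) (LocalRing L v)).map f * (Qw : Matrix (Fin 3) (Fin 3) (w.1.adicCompletion L))) *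
              ((Qw⁻¹ : GL (Fin 3) (w.1.adicCompletion L)) : Matrix (Fin 3) (Fin 3) (w.1.adicCompletion L)) := by rw [Matrix.mul_assoc]
      _ = (Qw : Matrix (Fin 3) (Fin 3) (w.1.adicCompletion L)) * diagonal (fun i => z i w) *
              ((Qw⁻¹ : GL (Fin 3) (w.1.adicCompletion L)) : Matrix (Fin 3) (Fin 3) (w.1.adicCompletion L)) := by rw [hQwval, h]; rfl
  have htw := hframe t ![x₁, x₂, x₃] hQ
  have ht'w := hframe t' ![Yv 0, Yv 1, Yv 2] hQ'
  have hxvec : (fun i => (![x₁, x₂, x₃] : Fin 3 → LocalRing L v) i w) = (![x₁ w, x₂ w, x₃ w] : Fin 3 → w.1.adicCompletion L) := by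
    funext i; fin_cases i <;> rfl
  have hYvec : (fun i => (![Yv 0, Yv 1, Yv 2] : Fin 3 → LocalRing L v) i w) = Yf := by
    funext i; fin_cases i
    · exact hYvw 0
    · exact hYvw 1
    · exact hYvw 2
  rw [hxvec] at htw
  rw [hYvec] at ht'w
  -- (6) the shifted order: `X = 1 + ϖ⁻¹(t_w − 1)`, `Y_w`, `Y_w⁻¹` in the common eigenframe `Q_w`
  have hxO : ∀ i, (![x₁ w, x₂ w, x₃ w] : Fin 3 → w.1.adicCompletion L) i ∈ 𝒪[w.1.adicCompletion L] := fun i => hmemO (by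
    rw [show (![x₁ w, x₂ w, x₃ w] : Fin 3 → w.1.adicCompletion L) i = 1 + ((![x₁ w, x₂ w, x₃ w] : Fin 3 → w.1.adicCompletion L) i - 1) by ring,
      Valuation.map_one_add_of_lt _ (hxw i)])
  have huO : ∀ i, ϖ⁻¹ * ((![x₁ w, x₂ w, x₃ w] : Fin 3 → w.1.adicCompletion L) i - 1) ∈ 𝒪[w.1.adicCompletion L] :=
    fun i => hmemO (valued_shift_le_one hdϖ.vϖ (hxw i))
  have hx1u : ∀ i, ∃ y ∈ 𝒪[w.1.adicCompletion L], y * ((![x₁ w, x₂ w, x₃ w] : Fin 3 → w.1.adicCompletion L) i + 1) = 1 := fun i =>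
    ⟨((![x₁ w, x₂ w, x₃ w] : Fin 3 → w.1.adicCompletion L) i + 1)⁻¹, hmemO (by rw [map_inv₀, hx1 i, inv_one]), inv_mul_cancel₀ (hx10 i)⟩
  have hZO : ∀ i, ϖ⁻¹ * (((![x₁ w, x₂ w, x₃ w] : Fin 3 → w.1.adicCompletion L) i - 1) / ((![x₁ w, x₂ w, x₃ w] : Fin 3 → w.1.adicCompletion L) i + 1)) ∈
      𝒪[w.1.adicCompletion L] := fun i => hmemO (hZle i)
  have hZm : ∀ i, ∃ y ∈ 𝒪[w.1.adicCompletion L],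
      y * (1 - ϖ⁻¹ * (((![x₁ w, x₂ w, x₃ w] : Fin 3 → w.1.adicCompletion L) i - 1) / ((![x₁ w, x₂ w, x₃ w] : Fin 3 → w.1.adicCompletion L) i + 1))) = 1 := fun i =>
    ⟨(1 - ϖ⁻¹ * (((![x₁ w, x₂ w, x₃ w] : Fin 3 → w.1.adicCompletion L) i - 1) / ((![x₁ w, x₂ w, x₃ w] : Fin 3 → w.1.adicCompletion L) i + 1)))⁻¹,
      hmemO (by rw [map_inv₀, (h1Z i).1, inv_one]), inv_mul_cancel₀ (h1Zm0 i)⟩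
  have hZp : ∀ i, ∃ y ∈ 𝒪[w.1.adicCompletion L],
      y * (1 + ϖ⁻¹ * (((![x₁ w, x₂ w, x₃ w] : Fin 3 → w.1.adicCompletion L) i - 1) / ((![x₁ w, x₂ w, x₃ w] : Fin 3 → w.1.adicCompletion L) i + 1))) = 1 := fun i =>
    ⟨(1 + ϖ⁻¹ * (((![x₁ w, x₂ w, x₃ w] : Fin 3 → w.1.adicCompletion L) i - 1) / ((![x₁ w, x₂ w, x₃ w] : Fin 3 → w.1.adicCompletion L) i + 1)))⁻¹,
      hmemO (by rw [map_inv₀, (h1Z i).2, inv_one]), inv_mul_cancel₀ (h1Zp0 i)⟩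
  have hspan : Submodule.span 𝒪[w.1.adicCompletion L]
        (Set.range fun j : Fin 3 => fun i => (1 + ϖ⁻¹ * ((![x₁ w, x₂ w, x₃ w] : Fin 3 → w.1.adicCompletion L) i - 1)) ^ (j : ℕ)) =
      Submodule.span 𝒪[w.1.adicCompletion L] (Set.range fun j : Fin 3 => fun i => Yf i ^ (j : ℕ)) := by
    rw [span_pow_one_add_eq _ huO, span_pow_shift_eq_span_pow_cayleyParam _ hϖU.mem hϖ0 h20 h2O hxO huO hx1u,
      span_pow_cayleyParam_eq_span_pow_cayley _ h20 h2O hZO hZm hZp, hYf]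
  have hYmem : Yf ∈ Submodule.span 𝒪[w.1.adicCompletion L] (Set.range fun j : Fin 3 => fun i => Yf i ^ (j : ℕ)) :=
    Submodule.subset_span ⟨1, funext fun i => by simp⟩
  have hsmem : (fun i => 1 + ϖ⁻¹ * ((![x₁ w, x₂ w, x₃ w] : Fin 3 → w.1.adicCompletion L) i - 1)) ∈ Submodule.span 𝒪[w.1.adicCompletion L]
      (Set.range fun j : Fin 3 => fun i => (1 + ϖ⁻¹ * ((![x₁ w, x₂ w, x₃ w] : Fin 3 → w.1.adicCompletion L) i - 1)) ^ (j : ℕ)) :=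
    Submodule.subset_span ⟨1, funext fun i => by simp⟩
  have hYinv : Yf⁻¹ ∈ Submodule.span 𝒪[w.1.adicCompletion L] (Set.range fun j : Fin 3 => fun i => Yf i ^ (j : ℕ)) := by
    rw [hYf]; exact cayley_inv_mem_span_pow _ hZO hZm hZp
  have hX_eq : 1 + ϖ⁻¹ • ((((localNonsplitEquiv (IsCMField.complexConj L) H' hc1 w hw t :
        unitaryGroupOfForm (galAdicCompletionMap (L := L) (IsCMField.complexConj L) hw) (placeForm H' w.1)) :
          GL (Fin 3) (w.1.adicCompletion L)) : Matrix (Fin 3) (Fin 3) (w.1.adicCompletion L)) - 1) =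
      (Qw : Matrix (Fin 3) (Fin 3) (w.1.adicCompletion L)) * diagonal (fun i => 1 + ϖ⁻¹ * ((![x₁ w, x₂ w, x₃ w] : Fin 3 → w.1.adicCompletion L) i - 1)) *
        ((Qw⁻¹ : GL (Fin 3) (w.1.adicCompletion L)) : Matrix (Fin 3) (Fin 3) (w.1.adicCompletion L)) := by
    rw [htw, conj_diagonal_one_add_mul_sub_one]
  have hYinv_eq : ((((localNonsplitEquiv (IsCMField.complexConj L) H' hc1 w hw t' :
        unitaryGroupOfForm (galAdicCompletionMap (L := L) (IsCMField.complexConj L) hw) (placeForm H' w.1)) :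
          GL (Fin 3) (w.1.adicCompletion L))⁻¹ : GL (Fin 3) (w.1.adicCompletion L)) : Matrix (Fin 3) (Fin 3) (w.1.adicCompletion L)) =
      (Qw : Matrix (Fin 3) (Fin 3) (w.1.adicCompletion L)) * diagonal Yf⁻¹ * ((Qw⁻¹ : GL (Fin 3) (w.1.adicCompletion L)) : Matrix (Fin 3) (Fin 3) (w.1.adicCompletion L)) := by
    rw [Matrix.coe_units_inv, ht'w, inv_conj_diagonal Qw hY0]
  -- (7) ROW 0 = #Fix(t′): ★ p846223 (`Y := (t′)_w`; `Y, Y⁻¹ ∈ 𝒪_w[X]`, `X ∈ 𝒪_w[Y]` by the matrix bridge), then back to `G′_v ⧸ K_v` and over to the `Φ₃`-model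
  have hJw : IsUnit (placeForm H' w.1) := isUnit_placeForm_of_isUnit_det ((Matrix.isUnit_iff_isUnit_det _).1 hH'u) w.1
  have h0 := ncard_fixedBy_rankStratum_zero_eq_natCard_fixedBy_of_mem_adjoin L 3 H' v w hw hJw hϖU t
    (localNonsplitEquiv (IsCMField.complexConj L) H' hc1 w hw t')
    (by rw [ht'w, hX_eq]; exact conj_diagonal_mem_adjoin_of_mem_span_pow _ Qw (by rw [hspan]; exact hYmem))
    (by rw [hYinv_eq, hX_eq]; exact conj_diagonal_mem_adjoin_of_mem_span_pow _ Qw (by rw [hspan]; exact hYinv))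
    (by rw [ht'w, hX_eq]; exact conj_diagonal_mem_adjoin_of_mem_span_pow _ Qw (by rw [← hspan]; exact hsmem))
  have hK : ∀ g : (cmDatum L 3 H').Local v, g ∈ cmLocalIntegralLevel L 3 H' v ↔
      (localNonsplitEquiv (IsCMField.complexConj L) H' hc1 w hw).toMulEquiv g ∈
        (glInt 3 (w.1.adicCompletion L)).subgroupOf (unitaryGroupOfForm (galAdicCompletionMap (L := L) (IsCMField.complexConj L) hw) (placeForm H' w.1)) :=
    fun g => (mem_localIntegralLevel_iff_of_smul_eq (IsCMField.complexConj L) 3 H' hc1 w hw g).trans Subgroup.mem_subgroupOf.symm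
  have e1 := natCard_fixedCosets_eq (localNonsplitEquiv (IsCMField.complexConj L) H' hc1 w hw).toMulEquiv hK t'
  have e2 := natCard_fixedBy_cmLocalIntegralLevel_eq_of_congr L H' w hw ψ hlev t'
  have h1P := one_le_of_valued_sub_eq_exp_neg hd₁ hd₃ hP
  have h1Q₁ := one_le_of_valued_sub_eq_exp_neg hd₁ hd₂ hQ₁
  have h1Q₂ := one_le_of_valued_sub_eq_exp_neg hd₃ hd₂ hQ₂
  refine ⟨Yv 0, Yv 1, Yv 2, t', hlit', ?_, ?_, ?_, ?_, ?_, ?_, hfin, ?_⟩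
  · rw [hYvw]; exact hYn 0
  · rw [hYvw]; exact hYn 1
  · rw [hYvw]; exact hYn 2
  · rw [hYvw, hYvw, hYsub 0 2, hdϖ.vϖ, ← exp_neg_div_exp_neg_one h1P, ← hP]; rfl
  · rw [hYvw, hYvw, hYsub 0 1, hdϖ.vϖ, ← exp_neg_div_exp_neg_one h1Q₁, ← hQ₁]; rfl
  · rw [hYvw, hYvw, hYsub 2 1, hdϖ.vϖ, ← exp_neg_div_exp_neg_one h1Q₂, ← hQ₂]; rfl
  · rw [h0]
    exact e1.symm.trans e2

end Core

end Literature.NumberTheory.Rogawski1990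

end
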